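import Summits.AtomisticToContinuum.Crystallization.Theses.PalmUnimodularRigidity
import Summits.AtomisticToContinuum.Crystallization.Theorems.PalmUnimodularRigidityMinimiserShellsEquilibriumInLaw
import Summits.AtomisticToContinuum.Crystallization.Theorems.PalmUnimodularRigidityLayeredLawsSelectHcpForceBalance
import Summits.AtomisticToContinuum.Crystallization.Theorems.PalmUnimodularRigidityCruxesToPalmRigidity
import Summits.AtomisticToContinuum.Crystallization.Theorems.PalmUnimodularRigidityUnimodularEnergyLowerBound
import Summits.AtomisticToContinuum.Crystallization.Theorems.LayeredLawsSelectHcp.Negative.FccModel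
import Literature.Probability.Process.PointStationaryLaw
import Literature.MathematicalPhysics.StatisticalMechanics.RootEnergy
import Literature.MathematicalPhysics.StatisticalMechanics.MuGSC
import Literature.MathematicalPhysics.StatisticalMechanics.BarlowStacking
import Literature.Geometry.DiscreteGeometry.KissingPatterns

/-!
# Line `equilibrium-liouville-localisation` — checked skeleton for crux `MinimiserShells`
(item stmt-AtomisticToContinuum-9225, route `PalmUnimodularRigidity`, rank 2; crux-plan, round 2)

Crux (by name; `minimiserShells_iff` of `Negative.LoadBearing` is `Iff.rfl`): every minimising
(`E_P[h] ≤ e*`) point-stationary `δ`-hard-core probability law on rooted configurations of `ℝ³`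
has, almost surely, an `(a/100)`-close-packed ROOT shell (`GoodShell`, `= GoodShellK 100`).

## The line (idea card `equilibrium-liouville-localisation`, ideator 4; TRIAGE-r2-1 / r2-2: pass, retype)

EQUILIBRIUM RIGIDITY INSTEAD OF ENERGY COERCIVITY FOR THE FINE STEP.  The crux's tolerance `a/100`
sits in the ELASTIC regime (cheapest violators: homogeneously strained close packings at
`4.4e-4 = 0.06 %·|e*|`, Disproof §5/§8); no energetic certificate should be asked to resolve that.
The line asks energy ONLY for the COARSE statement at tolerance `a/30` (STUB 1, ceiling ≈ 11×
higher) and closes `a/30 → a/100` by the RIGIDITY OF EQUILIBRIA: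

* move (1) of the card, FORCE BALANCE ALMOST SURELY, is FREE and already LANDED: a minimising law is
  a.s. carried by Sütő `μ`-ground-state configurations at chemical potential `e*`
  (`EquilibriumInLaw.stub_equilibriumInLaw`, line `equilibrium-in-law-surgery`), and every
  `δ`-separated `μ`GSC is a Lennard-Jones equilibrium at EVERY point
  (`LayeredLawsSelectHcp.tube_muGSC_forceBalance`) — combined here, sorry-free, as
  `ae_isLJEquilibrium`.  So the card's `ForceBalanceAS` is not a stub (it would be bookkeeping).
* STUB 1 `stub_coarseShells` (energetic interface, HARDEST, crux-class — see below): minimising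
  laws have `(a/30)`-good root shells a.s.  This is the junction with line A
  (`defect-exchange-two-resolutions`: solvency + exchange identity ⇒ `P(root awful) = 0`); this
  line lowers the resolution that certificate needs from `4.4e-4` to `≈ 4.9e-3 = 0.68 %·|e*|`.
* Palm transfer "root a.s. ⇒ every point a.s." is LANDED (`ae_forall_map_sub_of_ae`, item 9228)
  and used in the composition; not a stub.
* STUB 2 `stub_chart` (pure geometry): everywhere-`(a/30)`-good ⇒ Barlow-charted (crux 9227
  `ShellsToBarlowChart`, proved at `a/100` as `ShellsToBarlowChart_of`, with the hypothesis
  weakened to `a/30`; contact graph and shell type stay unambiguous below `a/10`).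
* STUB 3 `stub_liouville` (THE LEVER, deterministic): a uniformly discrete Lennard-Jones
  EQUILIBRIUM configuration all of whose points are `(a/30)`-good and which is Barlow-charted is a
  LAYER STACK — a union over `k : ℤ` of translates of ONE planar lattice (every layer exactly
  flat, parallel, equally and affinely strained).  Content: discrete elastostatic Liouville for
  the LJ lattice-statics difference system in the `a/30` tube (linear level = phonon /
  Legendre–Hadamard stability of every admissible homogeneous strain, kit j020582 below;
  nonlinear level = small-oscillation Campanato iteration / FJM rigidity in chart coordinates).
  Stated as an EXACT set identity: no approximation clause, so the vacuity that killed the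
  card's typed `EquilibriumLocalisation` (TRIAGE Lean `equilibriumLocalisation_trivial/_vacuous`:
  unconstrained `A`) cannot occur; layer origins (spacings, registry) are deliberately left free
  (equilibrium polytypes relax layer-wise, so "affine image of an IDEAL stacking" would be false).
* STUB 4 `stub_layerEndgame` (certified lattice sums + 1-D layer-chain rigidity): a layer stack
  that is a uniformly discrete `μ`GSC at `e*`, everywhere `(a/30)`-good and Barlow-charted, is
  everywhere `(a/100)`-good.  Mechanism: the `μ`GSC removal test pins the block energy density to
  `e*` from above and periodisation (`N e* ≤ U`) from below; in-plane strain is GLOBAL in a layer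
  stack (one planar lattice for all layers) and costs volume order, so the in-plane lattice is
  optimal; layer spacings / registry obey the layer-chain equilibrium equations (force balance,
  from `μ`GSC) whose bounded solutions in the coarse window are pinned `≈ 1e-4·a` from ideal
  (relaxed hcp `c/a − √(8/3) = −2.3e-4`, polytype layer relaxation `≤ 2.4e-5·a`, kit j010609 /
  j011122); either `e* < e_Barlow` (then no such configuration exists: vacuous) or the minimisers
  of the family are the near-ideal ones (certified interval lattice sums, margin ≈ 3e-4 per
  particle between the `a/100` strain threshold `4.4e-4` and the polytype spread `7.5e-5`).

`MinimiserShells_of : MinimiserShells` applies the four registered stubs BY NAME to the sorry-free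
`minimiserShells_of_stubs` (stub statements as hypotheses ⇒ the crux; glue = `minimiserShells_iff`,
`stub_equilibriumInLaw`, `unimodularEnergyLowerBound_proof` (9229, closed), `tube_muGSC_forceBalance`,
`ae_forall_map_sub_of_ae`, `count_restrict_floorNorm_preimage_lt_top`, `map_sub_count_restrict`,
`set_eq_of_count_restrict_eq`).  `lean check`: rc 0, sorries exactly the four stubs.

## Why `a/30` (kit j020582 of this seat, `kit/tube_phonon_scan.py`, attached to the item)

Phonon / Legendre–Hadamard scan of fcc and hcp LJ (`V = r⁻¹²/12 − r⁻⁶/6`, sums to `5.2`, hcp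
internal coordinate relaxed per strain, BZ grid 10³ + 158 long-wave directions) over homogeneous
strains `A = a(I+E)` that keep every shell `(1/K)`-good (deviation `dev(A) = min_{a'∈[0.9,1]}
max_j |A p_j − a' p_j|/a' ≤ 1/K`): NO admissible strain is unstable for any `K ≥ 20` (186 fcc +
192 hcp random admissible samples, 14 named paths); minimum stiffness ratios (min over BZ of
`λ_min(D_A(k))/|k|²`, and LH constant, relative to relaxed): `K = 20`: 0.19 / 0.13; `K = 25`:
0.35 / 0.29; `K = 30`: 0.37 / 0.31; `K = 40`: 0.43 / 0.44; `K = 100`: 0.55 / 0.55.  The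
instability surface sits at `dev ≈ 0.053–0.10` (`K ≈ 10–19`): hcp uniaxial in-plane compression
`−10 %` has `LH/LH* = 0.024` at `dev = 0.053`, hcp in-plane deviatoric `−6 %` and basal/prism
shear `12–13 %` go unstable at `dev ≈ 0.060–0.065`, fcc/hcp volume-preserving tetragonal
compression at `dev ≈ 0.061–0.077`; pure dilation is stable to NN `= 1.07` (`+10 %` over
`a* = 0.9712`).  So the card's `a/20` tube touches the Born-instability surface (where bifurcating
modulated equilibria would refute STUB 3 outright), while `a/30` keeps `≥ 31 %` of every acoustic
stiffness — TRIAGE-r2-2's "shrink the coarse tolerance to 1/30–1/40 so that bonds stay ≥ 30 %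
stiff", quantified.  Price: the coarse ceiling drops from `8.4e-3` (`a/20`) to `≈ 4.9e-3`
(`a/30`, quadratic interpolation of the kit ceilings), still `≈ 11×` the fine ceiling `4.4e-4`.
NONLINEAR FALSIFIER (TRIAGE-r2-1 sharpen 3; kit j020582 part 3, j020639, j020690): (a) root-finding on the force
map (Levenberg–Marquardt; Newton–Krylov) from 16–24 random `1–5 %` perturbations of strained 2×2×2 and
3×3×3 fcc cells at the `a/30` edge (NN `= 1.033`; tetragonal `±2.2 %`; shear `6.6 %`), the `a/20`
edge (tetragonal `−3.3 %`, `+3.4 %`) and `a/16` (tetragonal `−4 %`) returned the AFFINE state in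
every converged run; (b) FINITE AMPLITUDE AT THE SOFTEST LONG WAVES (j020690, shifted-force `C¹`
truncation at `r_c = 4`): for the six worst `a/30`-edge strains of fcc and of hcp, along the softest
commensurate phonon of `M × 1 × 1` supercells (`M = 8, 12`, each primitive direction; `ω²_min` down
to `0.098`), the frozen-phonon energy stays within `0.2 %` of harmonic up to amplitude `0.05a`
(ratio `≥ 0.998`, no softening) and L-BFGS relaxation from the `0.03a`-modulated state returns to
the affine lattice (`max|u| < 1e-7`, `|F| ≈ 1e-8`) in 72/72 runs — no non-affine periodic
equilibrium exists near the tube edge at these wavelengths; positive controls past the Born surface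
DO produce non-affine equilibria with the same code (fcc in-plane deviatoric `10 %`: converged
non-affine states with `max|u| = 0.16–0.30a`; fcc tetragonal `−6 %`, j020639: L-BFGS minima
`1.5e-2` per atom below affine, shells `≈ 1a` off pattern), while controls whose unstable direction
is incommensurate with the probe cell (fcc tetragonal `−5 %`, hcp in-plane `−6/−8 %` along `b_i`)
do not — so the null result is meaningful exactly at the probed wavelengths, and the linear
whole-tube scan remains the operative certificate elsewhere.  (The first frozen-phonon run j020676
used a sharp cutoff at `3.2` and showed spurious energy drops from pair crossings; superseded.)

## Relation to the certified residual (honest)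

By the landed sandwich `Residual.minimiserShells_sandwich` (p121752/p123347) every proof of the
crux proves `ShellGap θ`, `θ ∈ (0, 1/10]`; by the necessity mechanism (uniformly rooted blocks,
`PricingContainment`) STUB 1 at tolerance `a/30` implies the COARSE periodic shell gap (shell test
`a/30`-loose) — a statement of the same open class (3-D LJ crystallization in first-shell form,
BlancLewin2015 §2.3) at ≈ 11× coarser energy resolution.  This line does not claim a way round
it: its contribution is (i) the free, landed equilibrium structure, (ii) the reduction
`coarse ⇒ fine` by two deterministic rigidity theorems (STUBS 3, 4) plus geometry (STUB 2) that do
NOT touch the crystal problem, and (iii) a kit-quantified choice of the coarse tolerance.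

## Disproof.lean obstructions honoured (tree `Cruxes/MinimiserShells/Disproof.lean`, gen 1–3)

* `minimiserShells_false_without_energy` (§2a): `E_P[h] ≤ e*` is used twice — in
  `ae_isLJEquilibrium` (minimality ⇒ `μ`GSC ⇒ force balance) and as a hypothesis of STUB 1.
* `minimiserShells_false_without_stationarity` / `not_pointwiseMinimiserShells` (§2b–c): Mecke is
  used in `stub_equilibriumInLaw` (random-grid cell averaging), in the Palm transfer
  `ae_forall_map_sub_of_ae`, and inside STUB 1; no stub is a pointwise energy ⇒ shell certificate
  (STUBS 3–4 are deterministic but assume GLOBAL coarse-goodness + equilibrium, not root energy).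
* `minimiserShells_imp_unimodularEnergyLowerBound` (§3): 9229 is closed
  (`unimodularEnergyLowerBound_proof`) and passed by name to `stub_equilibriumInLaw`.
* `not_minimiserShellsSlack` (§4/§4b): no stub is stable under `E ↦ E + s` (STUB 1 uses exact
  minimality; STUB 4 uses the exact chemical potential `e*`).
* `linearPricing_ceiling(_partial)` (§5/§8): the fine predicate is never priced; STUB 1's ceiling
  is `≈ 4.9e-3` (coarse, `a/30`).
* §6a–c, §7, §9, §11: every law-level statement keeps `IsProbabilityMeasure`, unit atom masses,
  the full (infinite-range, genuinely re-rooting) Mecke identity; rootedness used only via `0 ∈ S`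
  at the last line; the finite world is never entered (STUBS 2–4 are about infinite configurations,
  as §11 demands of any witness).
* Landed `Theorems/MinimiserShells/Negative/*` (LoadBearing, HiddenDependency, UniformRooting,
  PricingCeiling, MultRooted, ReflectionOnly, Rootedness, Normalisation, LocalMecke,
  FiniteClusters): no stub is an instance — STUB 1 restricted to `unifRooted x` reads "uniformly
  rooted finite minimising clusters have coarse-good shells a.s.", vacuous by `FiniteClusters`
  (`eStar_lt_meanRootEnergy_unifRooted`: no finite cluster is minimising), not refuted; STUBS 2–4
  are deterministic statements about everywhere-good infinite sets (negatives 4146 / 3506 are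
  single-shell / one-grain statements, not instances).
-/

noncomputable section

open MeasureTheory
open scoped ENNReal

namespace Summit.AtomisticToContinuum.Crystallization.Cruxes.MinimiserShells.EquilibriumLiouvilleLocalisation

open Literature.Probability.Process (IsPointStationaryLaw IsRootedHardCore
  count_restrict_singleton_ne_zero_iff map_sub_count_restrict)
open Literature.MathematicalPhysics.StatisticalMechanics (lennardJones PeriodicConfiguration
  IsHaggSeq barlowStacking IsMuGSC UniformlyDiscrete)
open Literature.Geometry.DiscreteGeometry (ShellCloseTo fccKissingPattern hcpKissingPattern)
open Summit.AtomisticToContinuum.Crystallization.Theses.PalmUnimodularRigidity (MinimiserShells)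
open Summit.AtomisticToContinuum.Crystallization.Theorems.MinimiserShells.Negative.LoadBearing
  (eStar meanRootEnergy GoodShell minimiserShells_iff)
open Summit.AtomisticToContinuum.Crystallization.Theorems.PalmUnimodularRigidityMinimiserShells.EquilibriumInLaw
  (stub_equilibriumInLaw)
open Summit.AtomisticToContinuum.Crystallization.Theorems.PalmUnimodularRigidity
  (ae_forall_map_sub_of_ae count_restrict_floorNorm_preimage_lt_top)
open Summit.AtomisticToContinuum.Crystallization.Theorems.PalmUnimodularRigidity.LayeredLawsSelectHcp
  (tube_muGSC_forceBalance)
open Summit.AtomisticToContinuum.Crystallization.Theorems.LayeredLawsSelectHcp.Negative.FccModel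
  (set_eq_of_count_restrict_eq)
open Summit.AtomisticToContinuum.Crystallization.Theorems (unimodularEnergyLowerBound_proof)

/-- Euclidean 3-space. -/
abbrev E3 := EuclideanSpace ℝ (Fin 3)

/-! ## Vocabulary -/

/-- **Good root shell at tolerance `a/K`** for a rooted configuration `μ`: for some scale
`a ∈ [9/10, 1]` the atoms `y ≠ 0` with `‖y‖ ≤ 5a/4` form a finite set that is `(a/K)`-matched,
after a linear isometry, to the `a`-scaled FCC or HCP kissing pattern.  `K = 100` is the crux's
conclusion verbatim (`goodShellK_hundred_iff`); `K = 30` is the COARSE tolerance of this line (kit j020582). -/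
def GoodShellK (K : ℝ) (μ : Measure E3) : Prop :=
  ∃ a : ℝ, 9 / 10 ≤ a ∧ a ≤ 1 ∧ ∃ T : Finset E3,
    (↑T : Set E3) = {y : E3 | μ {y} ≠ 0 ∧ y ≠ 0 ∧ ‖y‖ ≤ 5 / 4 * a} ∧
    (ShellCloseTo (a / K) T (Finset.image (fun v : E3 => a • v) fccKissingPattern) ∨
      ShellCloseTo (a / K) T (Finset.image (fun v : E3 => a • v) hcpKissingPattern))

/-- `GoodShellK 100` is the crux's predicate `GoodShell` (definitional). [folklore] -/
theorem goodShellK_hundred_iff (μ : Measure E3) : GoodShellK 100 μ ↔ GoodShell μ := Iff.rfl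

/-- **Good shell at a point `x` of a point set `S`**: the shell of the configuration `count|S`
re-rooted at `x` (`= count|(S − x)`, `map_sub_count_restrict`). -/
def GoodShellAt (K : ℝ) (S : Set E3) (x : E3) : Prop :=
  GoodShellK K ((Measure.count : Measure E3).restrict ((fun y => y - x) '' S))

/-- **Lennard-Jones equilibrium configuration** (force balance at EVERY point; the `HasSum` form of
the landed `tube_muGSC_forceBalance`): `Σ_{q ∈ S, q ≠ p} V′(|p − q|)(p − q)/|p − q| = 0`. -/
def IsLJEquilibrium (S : Set E3) : Prop :=
  ∀ p ∈ S, HasSum (fun q : {q : E3 // q ∈ S ∧ q ≠ p} =>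
    (deriv lennardJones (dist p q.1) / dist p q.1) • (p - q.1)) (0 : E3)

/-- **Barlow chart** (the conclusion of crux `ShellsToBarlowChart`, verbatim): `S` is
bond-isomorphic to the ideal Barlow stacking of some Hägg word. -/
def IsBarlowCharted (S : Set E3) : Prop :=
  ∃ s : ℤ → ℤ, IsHaggSeq s ∧ ∃ Φ : E3 → E3,
    Set.BijOn Φ (barlowStacking 1 (Real.sqrt (2 / 3)) s) S ∧
    ∀ p ∈ barlowStacking 1 (Real.sqrt (2 / 3)) s, ∀ q ∈ barlowStacking 1 (Real.sqrt (2 / 3)) s,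
      (dist p q = 1 ↔ (0 < dist (Φ p) (Φ q) ∧ dist (Φ p) (Φ q) ≤ 28 / 25))

/-- **Layer stack**: `S` is a union, over `k : ℤ`, of translates `p k + Λ` of ONE planar lattice
`Λ = ℤ e₁ + ℤ e₂` — every layer flat, parallel to the others and carrying the SAME in-plane
lattice; the layer origins `p k` (spacings and lateral registry) are unconstrained.  This is the
conclusion of the Liouville stub (in-plane affinity), stated as an EXACT set identity (no
approximation clause, hence no vacuity through degenerate maps). -/
def IsLayerStack (S : Set E3) : Prop :=
  ∃ e₁ e₂ : E3, ∃ p : ℤ → E3,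
    S = {x : E3 | ∃ k i j : ℤ, x = p k + (i : ℝ) • e₁ + (j : ℝ) • e₂}

/-! ## The four registered stubs -/

/-- **STUB 1 — coarse shells almost surely (energetic interface; HARDEST; crux-class).**  For every
hard core `δ > 0`, every minimising (`E_P[h] ≤ e*`) point-stationary `δ`-hard-core probability law
has an `(a/30)`-good ROOT shell almost surely (`GoodShellK 30`: twelve atoms within `5a/4`,
`(a/30)`-matched after a linear isometry to the `a`-scaled FCC or HCP pattern, `a ∈ [9/10, 1]`).
Role: the junction with the energetic certificate of line A (`defect-exchange-two-resolutions`: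
per-cell solvency + Mecke exchange ⇒ `P(root awful) = 0`) — any zero-loss pricing of the COARSE
bad event delivers exactly this.  Ceiling a certificate must respect: `c ≤ e(Q) − e*` for every
periodic `Q` all of whose shells are `(a/30)`-bad — `≈ 4.9e-3 = 0.68 %·|e*|` from homogeneously
strained close packings (kit j010899/j020414 ceilings `8.4e-3` at `a/20`, `4.4e-4` at `a/100`,
quadratic in the threshold strain), `3.1e-2` bcc, `≥ 1 %` every tabulated TCP structure.
HONEST STATUS: by the necessity half of `Residual.minimiserShells_sandwich` run at tolerance `a/30`
(uniformly rooted blocks, `PricingContainment`) this stub implies the COARSE periodic shell gap —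
3-D Lennard-Jones crystallization in first-shell form at ≈ 11× coarser resolution than the crux
(BlancLewin2015 §2.3: open).  Why it might fail: a minimising point-stationary hard-core law with
a positive probability of `(a/30)`-bad (icosahedral / polytetrahedral / Frank–Kasper / `> 3 %`
strained) root shells, i.e. a non-close-packed Lennard-Jones ground state. -/
theorem stub_coarseShells :
    ∀ δ : ℝ, 0 < δ → ∀ P : Measure (Measure E3), IsProbabilityMeasure P →
      (∀ᵐ μ ∂P, IsRootedHardCore δ μ) → IsPointStationaryLaw P → meanRootEnergy P ≤ eStar →
      ∀ᵐ μ ∂P, GoodShellK 30 μ := by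
  sorry

/-- **STUB 2 — robust layer theorem at tolerance `a/30` (pure geometry, no potential, no measure).**
A non-empty set every point of which has an `(a/30)`-good shell (`GoodShellAt 30 S x`: the shell
of `count|(S − x)`) is bond-isomorphic to an ideal Barlow stacking (`IsBarlowCharted`: a Hägg word
`s` and a bijection `Φ : barlowStacking 1 √(2/3) s → S` with ideal contacts `↔` pairs at distance
in `(0, 28/25]`).  This is crux 9227 `ShellsToBarlowChart` — PROVED at `a/100`
(`Cruxes/ShellsToBarlowChart/…/ShellsToBarlowChart_of`) — with the hypothesis weakened to `a/30`:
shell TYPE (FCC vs HCP patterns differ by a 60° twist moving three points by `0.58a ≫ 2a/30`) and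
contact graph (contacts `≤ 1.067a` vs non-contacts `≥ 1.35a`) stay unambiguous, the window
`(0, 28/25]` still separates shell pairs (`≤ 1.034`) from all others (`> 5a/4 ≥ 1.125`).
Why it might fail: the metric propagation steps of the `a/100` proof (coplanarity of the hexagon,
no room for a 13th ball) have finite slack that may not reach `a/30`; an everywhere-`(a/30)`-good
Delone set with exotic global layer topology would break the single Hägg word. [difficulty: L] -/
theorem stub_chart :
    ∀ S : Set E3, S.Nonempty → (∀ x ∈ S, GoodShellAt 30 S x) → IsBarlowCharted S := by
  sorry

/-- **STUB 3 — discrete elastostatic Liouville for coarse-good equilibria (THE LEVER; deterministic).**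
A uniformly discrete Lennard-Jones EQUILIBRIUM configuration (`IsLJEquilibrium`: zero net force at
every point, the landed `HasSum` form) all of whose points are `(a/30)`-good and which is
Barlow-charted is a LAYER STACK (`IsLayerStack`: `S = ⋃_k (p k + ℤe₁ + ℤe₂)` EXACTLY — every layer
flat, parallel, carrying the same planar lattice; layer origins `p k` free).  Mechanism: in chart
coordinates the configuration is a bounded-distortion displacement of a Barlow stacking with
discrete strain in the `a/30` tube; force balance is a quasilinear elliptic DIFFERENCE SYSTEM
(infinite-range, `r⁻⁷`-summable coefficients); FJM geometric rigidity pins the rotation field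
globally up to `O(1/30)`; LINEAR LEVEL (certified numerically, kit j020582): every admissible
homogeneous strain of fcc/hcp in the `a/30` tube is phonon-stable with `≥ 37 %` of the relaxed
`min_k λ_min(D(k))/|k|²` and `≥ 31 %` of the Legendre–Hadamard constant, so bounded solutions of
the linearised system are affine (Fourier: `D_A(k) > 0` for `k ≠ 0`); NONLINEAR LEVEL: small-
oscillation Liouville (discrete Caccioppoli ⇒ Campanato decay ⇒ entire solutions with strain
oscillation `≤ 2/30` are in-plane affine), layer origins absorbing the layer-rigid (optical /
`k ∥ c`) modes, which is why they are left free.  Literature shape: Liouville for nonlinear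
elliptic systems under small gradient oscillation (Giaquinta–Modica type), lattice statics
existence/decay (Ehrlacher–Ortner–Shapeev ARMA 222 (2016), Hudson–Ortner), Cauchy–Born validity
near stable states (E–Ming 2007, Conti–Dolzmann–Kirchheim–Müller 2006); unwritten for LJ with tail.
Why it might fail: a force-balanced, everywhere-`(a/30)`-good, Barlow-charted configuration with
a NON-affine in-plane displacement — a "frozen elastic wave"; excluded at the linear level by the
kit scan (the bifurcation surface of modulated equilibria sits at shell deviation `0.053–0.10`,
i.e. tolerance `a/19–a/10`), and the small-oscillation constant of the nonlinear argument may
demand a tube narrower than `a/30` (then reshape `30 ↦ 40/50` here AND in STUBS 1, 2, 4; the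
composition is unchanged).  A lead may also weaken this stub by adding the hypothesis
`IsMuGSC lennardJones eStar S` (in scope in the composition as `hgsc`). [difficulty: XL] -/
theorem stub_liouville :
    ∀ S : Set E3, UniformlyDiscrete S → IsLJEquilibrium S →
      (∀ x ∈ S, GoodShellAt 30 S x) → IsBarlowCharted S → IsLayerStack S := by
  sorry

/-- **STUB 4 — layer-stack endgame (energetics of an explicit family; certified lattice sums +
1-D layer-chain rigidity).**  A layer stack `S` that is uniformly discrete, a Sütő `μ`-ground-state
configuration of Lennard-Jones at chemical potential `e*` (`IsMuGSC lennardJones eStar S`, landed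
a.s. structure of minimisers), everywhere `(a/30)`-good and Barlow-charted is everywhere
`(a/100)`-good.  Mechanism: (i) ENERGY PINNING — the removal test of the `μ`GSC (`IsMuGSC.removal`
with `k = 0`) gives `E_int(B) + E(B, S∖B) ≤ e*·|B|` for every finite block, i.e. block energy
density `≤ e* + O(|∂B|/|B|)`, while periodisation (`N e* ≤ U`, landed in `EquilibriumInLaw`) gives
`≥ e*`; (ii) IN-PLANE OPTIMALITY — the planar lattice `ℤe₁ + ℤe₂` is common to all layers, so an
in-plane strain `ε` costs `κ ε²` per particle in EVERY layer (volume order): density `e*` forces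
`ε ≈ 0` if `e* = e_Barlow := inf` over the family, and NO such `S` exists if `e* < e_Barlow`
(vacuous case — the line never decides hcp-vs-exotic, STUB 1 did); (iii) LAYER CHAIN — spacings
and registry of consecutive layers solve the layer equilibrium equations (force balance from the
`μ`GSC via `tube_muGSC_forceBalance`, summed over a layer), a 1-D elliptic recurrence dominated by
the nearest-layer stiffness (`C33`, `C44 > 0`), whose solutions inside the coarse window are pinned
within `≈ 1e-4·a` of the ideal Hägg-word geometry (kit j010609: relaxed hcp `c/a = 1.632764`,
in-plane vs out-of-plane NN `0.971274` vs `0.971183`; j011122: polytype layer relaxation `≤ 2.4e-5·a`);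
(iv) CERTIFIED SUMS — over the compact coarse window of (in-plane metric, spacing, registry) the
energy per particle of every Hägg word exceeds its near-ideal minimum by a quadratic gap, and every
configuration outside the `(a/100)`-good set costs `≥ 4.4e-4 − 7.5e-5 ≈ 3.7e-4` per particle more
than relaxed hcp (interval lattice sums with `r⁻⁶` tail bounds, uniform in the Hägg word through
the `m⁻⁴` interlayer decay; HaggStacking/BarlowStacking machinery in tree).  Why it might fail: a
strained or mis-registered stacking inside the `a/30` window with energy within `7.5e-5` of relaxed
hcp (contradicts all lattice-sum numerics by `≥ 4×`), a second zero of the interlayer traction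
inside the coarse gap window (kit j010899 A: energy convex along tetragonal/shear paths to 10 %),
or hcp's linear strain-GRADIENT coupling (`T_yyy = ±0.1456`, TRIAGE-r2-2) — absent here because a
layer stack has NO in-plane strain gradient. [difficulty: L/XL] -/
theorem stub_layerEndgame :
    ∀ S : Set E3, IsLayerStack S → UniformlyDiscrete S → IsMuGSC lennardJones eStar S →
      (∀ x ∈ S, GoodShellAt 30 S x) → IsBarlowCharted S → ∀ x ∈ S, GoodShellAt 100 S x := by
  sorry

/-! ## Composition (sorry-free): the four stub STATEMENTS imply the crux BY NAME -/

/-- FREE STRUCTURE (landed): almost every sample of a minimising point-stationary hard-core law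
is a Sütő `μ`-ground-state configuration at chemical potential `e*` (`stub_equilibriumInLaw`,
line `equilibrium-in-law-surgery`), hence — card move (1), `ForceBalanceAS` — a Lennard-Jones
EQUILIBRIUM at every point (`tube_muGSC_forceBalance`). [folklore] -/
theorem ae_isLJEquilibrium {δ : ℝ} (hδ : 0 < δ) (P : Measure (Measure E3))
    (hP : IsProbabilityMeasure P) (hcore : ∀ᵐ μ ∂P, IsRootedHardCore δ μ)
    (hstat : IsPointStationaryLaw P) (hE : meanRootEnergy P ≤ eStar) :
    ∀ᵐ μ ∂P, ∃ S : Set E3, μ = (Measure.count : Measure E3).restrict S ∧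
      IsMuGSC lennardJones eStar S ∧ IsLJEquilibrium S := by
  filter_upwards [hcore, stub_equilibriumInLaw unimodularEnergyLowerBound_proof δ hδ P hP hcore hstat hE]
    with μ hc hg
  obtain ⟨S, -, hsep, rfl⟩ := hc
  obtain ⟨S', hS', hgsc⟩ := hg
  have hSS' : S = S' := set_eq_of_count_restrict_eq hS'
  subst hSS'
  exact ⟨S, rfl, hgsc, fun p hp => tube_muGSC_forceBalance δ eStar hδ S hsep hgsc p hp⟩

/-- **The logic of the line, sorry-free.**  The four stub statements, taken as hypotheses (so the
axiom closure of this lemma is clean), imply the crux: minimality ⇒ a.s. `μ`GSC ⇒ force balance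
at every point (tree); STUB 1 ⇒ a.s. coarse-good root ⇒ (Palm transfer, tree) coarse-good at
every point; STUB 2 chart; STUB 3 Liouville ⇒ layer stack; STUB 4 ⇒ fine-good at the root. -/
theorem minimiserShells_of_stubs
    (h1 : ∀ δ : ℝ, 0 < δ → ∀ P : Measure (Measure E3), IsProbabilityMeasure P →
      (∀ᵐ μ ∂P, IsRootedHardCore δ μ) → IsPointStationaryLaw P → meanRootEnergy P ≤ eStar →
      ∀ᵐ μ ∂P, GoodShellK 30 μ)
    (h2 : ∀ S : Set E3, S.Nonempty → (∀ x ∈ S, GoodShellAt 30 S x) → IsBarlowCharted S)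
    (h3 : ∀ S : Set E3, UniformlyDiscrete S → IsLJEquilibrium S →
      (∀ x ∈ S, GoodShellAt 30 S x) → IsBarlowCharted S → IsLayerStack S)
    (h4 : ∀ S : Set E3, IsLayerStack S → UniformlyDiscrete S → IsMuGSC lennardJones eStar S →
      (∀ x ∈ S, GoodShellAt 30 S x) → IsBarlowCharted S → ∀ x ∈ S, GoodShellAt 100 S x) :
    MinimiserShells := by
  rw [minimiserShells_iff]
  intro δ hδ P hP hcore hstat hE
  -- STUB 1: the root shell is coarse-good, a.s.
  have hroot : ∀ᵐ μ ∂P, GoodShellK 30 μ := h1 δ hδ P hP hcore hstat hE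
  -- hard-core configurations are locally finite
  have hlf : ∀ᵐ μ ∂P, ∀ n : ℕ, μ ((fun z : E3 => ⌊‖z‖⌋₊) ⁻¹' {n}) < ∞ := by
    filter_upwards [hcore] with μ hμ n
    obtain ⟨S, -, hsep, rfl⟩ := hμ
    exact count_restrict_floorNorm_preimage_lt_top hδ hsep n
  -- Palm transfer: coarse-good at EVERY point, a.s.
  have hall := ae_forall_map_sub_of_ae hstat hlf hroot
  filter_upwards [hcore, ae_isLJEquilibrium hδ P hP hcore hstat hE, hall] with μ hc hg ha
  obtain ⟨S, h0, hsep, rfl⟩ := hc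
  obtain ⟨S', hS', hgsc, heq⟩ := hg
  have hSS' : S = S' := set_eq_of_count_restrict_eq hS'
  subst hSS'
  have hgood : ∀ x ∈ S, GoodShellAt 30 S x := by
    intro x hx
    have h := ha x ((count_restrict_singleton_ne_zero_iff S x).2 hx)
    rwa [map_sub_count_restrict] at h
  have hUD : UniformlyDiscrete S := ⟨δ, hδ, hsep⟩
  have hchart : IsBarlowCharted S := h2 S ⟨0, h0⟩ hgood
  have hstack : IsLayerStack S := h3 S hUD heq hgood hchart
  have hfine : GoodShellAt 100 S 0 := h4 S hstack hUD hgsc hgood hchart 0 h0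
  have himg : (fun y : E3 => y - 0) '' S = S := by simp
  unfold GoodShellAt at hfine
  rw [himg] at hfine
  exact (goodShellK_hundred_iff _).1 hfine

/-- **`MinimiserShells_of`** — the skeleton theorem: the crux
`Summit.AtomisticToContinuum.Crystallization.Theses.PalmUnimodularRigidity.MinimiserShells` BY NAME
from the four registered stubs (the only declarations of this file containing `sorry`). -/
theorem MinimiserShells_of : MinimiserShells :=
  minimiserShells_of_stubs stub_coarseShells stub_chart stub_liouville stub_layerEndgame

end Summit.AtomisticToContinuum.Crystallization.Cruxes.MinimiserShells.EquilibriumLiouvilleLocalisation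

end
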